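import Summits.CriticalPhenomena.Ising3DConformalLimit.Theses.UnitLightCone
import Summits.CriticalPhenomena.Ising3DConformalLimit.Theses.ClusterRigidity
import Summits.CriticalPhenomena.Ising3DConformalLimit.Theses.BallOrbitComparison
import HarnessLib

/-!
# Crux `UnitLightCone.ClusterSetTotallyDisconnected` (stmt-CriticalPhenomena-4659) — line `cluster-light-cone`

Strategist `planner-cstrat-stmt-CriticalPhenomena-4659-b1-0` (crux-strategist BEFORE the lead), 2026-08-17.
Route `route-CriticalPhenomena-UnitLightCone` (the crux is the gen-6 child of `ExistsScaleCovariantLimit`,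
shared verbatim by ClusterRigidity / HRP / GSM / MonotoneRG / …; `ClusterSetTotallyDisconnected_of` below
concludes the UnitLightCone copy BY NAME; every other copy is the same term up to `Iff.rfl`).

## The crux

`IsTotallyDisconnected 𝒞` for the cluster set
`𝒞 := {S : CorrFamily 3 | S = 0 off NonCoincident ∧ ∃ u_k ∈ (0,1], u_k → 0, ∀ n, F_{u_k}(n,·) → S n l.u. on NonCoincident 3 n}`
of the SELF-NORMALISED critical correlators `F_δ(n,x) = ρ★(δ)^n ⟨∏ σ_{⌊xᵢ/δ⌋}⟩_{β_c(3)}`,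
`ρ★(δ) = ⟨σ₀σ_{⌊1/δ⌋e₀}⟩^{-1/2}` (product topology of `CorrFamily 3`).

## The cut — THE ROUTE'S LIGHT CONE, RUN AT CLUSTER LEVEL, WITHOUT HOMOGENEITY

The registered birth line cuts the crux along `π₂ : S ↦ S 2` into `stub_twoPointImageTD` (all two-point
cluster functions form a totally disconnected set — under compactness: ONE two-point function) and
`stub_fibrewiseTD` (isolation at fixed two-point function).  Its card discharges stub 1 from
`DimensionPinned + scale covariance + pinned frame`, which is NOT enough: (i) scale covariance of a cluster
point's two-point function is itself a CONSEQUENCE of stub 1 (landed `twoPoint_scaleCovariant_of_twoPointImageTD`,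
lead c18) and cannot be assumed, and (ii) even a homogeneous pinned cluster kernel `K_S(x) = S 2 (0,x)` is only
`|x|^{-2Δ} h_S(x/|x|)` with a free cubic-symmetric ANGULAR PROFILE `h_S`; the tree's isotropy theorems
(`HRP2Rigidity_of`, `kernel_rotation_invariant`, the route's own `LightConeRoundness`) all consume HOMOGENEITY
and full-filter limits, neither of which a cluster point has.

This line repairs exactly that, with the route's own lever:

* `stub_radialRigidity` (NEW, model-blind, provable now — the technique): a positive kernel `K` on `ℝ³ ∖ 0`
  with an upper envelope `K ≤ C‖x‖^{-a}`, `0 ≤ a < 4`, invariant under the hyperoctahedral group and admitting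
  a unit-cone Källén–Lehmann representation in the axis frame `e₂` is RADIAL (`‖x‖ = ‖y‖ → K x = K y`).
  NO homogeneity, NO continuity, ONE axis frame (the diagonal frame of the route's (US) is not needed).
  Pen proof (strategist, checked twice; see `Lines/cluster-light-cone.md`): transport the `e₂`-rep to the
  frames `±e₀, ±e₁` by the signed permutations; on the complexified latitude circle
  `ψ ↦ p(ψ) = s cos ψ e₀ + s sin ψ e₁ + c e₂` the `±e₀`-reps extend `K ∘ p` holomorphically to
  `{cos Re ψ ≷ 0}` and the `±e₁`-reps to `{sin Re ψ ≷ 0}` (tube condition `Re t > |Im w|` reads `cos α · e^{-|β|} > 0`),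
  the four pieces agree on real overlaps, so `K ∘ p` is ENTIRE and `2π`-periodic with
  `|F(α+iβ)| ≤ K((s/√2) e^{-|β|} e_j) ≤ C (s/√2)^{-a} e^{a|β|}` — exponential type `≤ a < 4` — hence a
  trigonometric polynomial of degree `< 4` (Fourier coefficients `|c_m| ≤ C' e^{a|β| + mβ}` for every `β`);
  the quarter turn about `e₂` (hyperoctahedral) forces `m ∈ 4ℤ`, so `F` is constant: `K` is invariant under all
  rotations about `e₂`, likewise about `e₀`, and these generate `SO(3)` (Euler angles).  The landed negatives
  of `LightConeRoundness` (`Negative/FalseWithoutMirrors`: ellipsoid with both unit cones;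
  `Negative/FalseWithoutIsingLimit`: blind family) both break hyperoctahedral invariance — honoured as a hypothesis.
* `stub_axisRV` = item stmt-CriticalPhenomena-5047 `BallOrbitComparison.TwoPointRegularVariation` BY NAME
  (`ρ★(cδ)/ρ★(δ) → c^{-Δ}`: the axis two-point function `g(m) = ⟨σ₀σ_{me₀}⟩_{β_c}` is regularly varying —
  "η exists in Karamata form"; OPEN, lattice, ONE-dimensional: by RP `g` is a Hausdorff moment sequence
  (ADC21 Prop 8.6), so this is regular variation of ONE spectral measure at its edge).
* `stub_clusterKernelOfRV` (provable now, M–L): under 5047 every member `S` of `𝒞` has a two-point kernel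
  `K_S x = S 2 (0,x)` which is translation invariant, positive off `0`, hyperoctahedrally invariant, has the
  PINNED AXIS PROFILE `K_S(r e₀) = r^{-2Δ}` (the RV limit read along the cluster sequence — exact, no floors)
  and the envelope `K_S x ≤ C‖x‖^{-2Δ}` with `1/2 ≤ Δ ≤ 1` (Messager–Miracle-Solé sandwich inherited along
  the subsequence; Potter bounds from `c m⁻² ≤ g ≤ C m⁻¹`).  Inputs all landed: `isTranslationInvariant_of_isClusterPoint`,
  `clusterPoint_nondeg_two`, `continuousOn_of_isClusterPoint`, `criticalTwoPoint_axis_sandwich`,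
  `criticalTwoPoint_axis_antitone`, `criticalTwoPoint_bounds_holds`, `isClusterPoint_of_mem_clusterSet`.
* `stub_clusterUnitCone` (OPEN — the route's rank-2 bet (US) `UnitSpeedTwoPoint`, first clause, at CLUSTER
  level): every member of `𝒞` has a unit-cone Källén–Lehmann representation of `x ↦ S 2 (0,x)` in the axis
  frame `e₂`.  Existence of SOME positive KL measure is inheritable from nine-mirror RP (Bernstein–Bochner on the
  `*`-semigroup `ℝ₊ × ℝ²`); the CONE SUPPORT is the content and is, exactly as for (US), the limit of the lattice
  spectral-edge statement `m(k) ≥ (1 − o(1))|k|` (route header, TWO-LAYER PLAN) — Helly works along subsequences,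
  so this is NOT a bet beyond the route's own layer 2.
* `stub_fibrewiseTD` = the birth line's registered load-bearing stub VERBATIM (isolation at fixed two-point
  function; the `n ≥ 4` identification; open-problem, engine-less here as there — HARDEST stub).

Composition (`ClusterSetTotallyDisconnected_of`, kernel-checked, no sorry): 5047 ⟹ (stub 2) facts with one
`Δ ∈ [1/2,1]`; for `S ∈ 𝒞`, stub 4 at `a = 2Δ ≤ 2 < 4` with stub 3's representation makes `K_S` radial, so
`K_S x = K_S(‖x‖ e₀) = ‖x‖^{-2Δ}`; by translation invariance and normalisation `S 2 = G★_Δ` for EVERY `S ∈ 𝒞`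
(`G★_Δ z = ‖z 1 − z 0‖^{-2Δ}` off the diagonal, `0` on it); a one-point image is totally disconnected, the fibres
are totally disconnected by stub 5, and the proved fibre lemma `isTotallyDisconnected_of_fibres` (birth glue,
re-proved here to keep the file import-free of sorried modules) gives the crux.

What the line buys (route UnitLightCone): the whole `n = 2` half of the identification problem becomes the
ONE-DIMENSIONAL statement 5047 about the axis function `g` plus the route's own spectral bet; the angular
identification, which no other line of this crux addresses, is a THEOREM of the light cone.  What it does not buy:
`stub_fibrewiseTD` (all orders `n ≥ 4`) is untouched.
-/

set_option maxHeartbeats 1000000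

namespace Summit.CriticalPhenomena.Ising3DConformalLimit.Cruxes.ClusterSetTotallyDisconnected.ClusterLightCone

open scoped BigOperators Topology Classical MeasureTheory InnerProductSpace
open Filter Set Function TopologicalSpace MeasureTheory


/-- stub 1 = item stmt-CriticalPhenomena-5047 `BallOrbitComparison.TwoPointRegularVariation` BY NAME (OPEN, lattice,
one-dimensional): the pinned renormalisation is regularly varying, `ρ★(cδ)/ρ★(δ) → c^{-Δ}` as `δ → 0⁺` for every
`c > 0`, i.e. `m ↦ ⟨σ₀σ_{me₀}⟩_{β_c(3)}` is regularly varying of index `-2Δ` ("η exists in Karamata form"). -/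
theorem stub_axisRV : Summit.CriticalPhenomena.Ising3DConformalLimit.Theses.BallOrbitComparison.TwoPointRegularVariation := by
  sorry


/-- stub 2 (provable now, M–L; inheritance along the cluster sequence): under axis regular variation every member `S`
of the cluster set has a two-point kernel `x ↦ S 2 (0,x)` that is translation invariant, positive off `0`,
hyperoctahedrally invariant, has the pinned axis profile `r^{-2Δ}` and the Messager–Miracle-Solé envelope
`≤ C‖x‖^{-2Δ}`, with ONE `Δ ∈ [1/2, 1]` for all cluster points. -/
theorem stub_clusterKernelOfRV : open Literature.Probability.LatticeModels in Summit.CriticalPhenomena.Ising3DConformalLimit.Theses.BallOrbitComparison.TwoPointRegularVariation → ∃ Δ : ℝ, 1/2 ≤ Δ ∧ Δ ≤ 1 ∧ ∀ S ∈ {S : CorrFamily 3 | (∀ n x, x ∉ NonCoincident 3 n → S n x = 0) ∧ ∃ u : ℕ → ℝ, (∀ k, u k ∈ Set.Ioc (0:ℝ) 1) ∧ Filter.Tendsto u Filter.atTop (nhds 0) ∧ ∀ n, TendstoLocallyUniformlyOn (fun k => rescaledCorrelator (criticalCorr 3) (fun δ : ℝ => (criticalTwoPoint 3 (Pi.single 0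 ⌊δ⁻¹⌋)) ^ (-(1/2:ℝ))) n (u k)) (S n) Filter.atTop (NonCoincident 3 n)}, (∀ x y : EuclideanSpace ℝ (Fin 3), x ≠ y → S 2 ![x, y] = S 2 ![0, y - x]) ∧ (∀ x : EuclideanSpace ℝ (Fin 3), x ≠ 0 → 0 < S 2 ![0, x]) ∧ (∀ R : EuclideanSpace ℝ (Fin 3) ≃ₗᵢ[ℝ] EuclideanSpace ℝ (Fin 3), (∀ i : Fin 3, ∃ j : Fin 3, R (EuclideanSpace.single i 1) = EuclideanSpace.single j 1 ∨ R (EuclideanSpace.single i 1) = -EuclideanSpace.single j 1) → ∀ x : EuclideanSpace ℝ (Fin 3), S 2 ![0, R x] = S 2 ![0, x]) ∧ (∀ r : ℝ, 0 < r → S 2 ![0, r • EuclideanSpace.single (0 : Fin 3) (1:ℝ)] = r ^ (-(2 * Δ))) ∧ (∃ C : ℝ, ∀ x : EuclideanSpace ℝ (Fin 3), x ≠ 0 → S 2 ![0, x] ≤ C * ‖x‖ ^ (-(2 * Δ))) := by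
  sorry


/-- stub 3 (OPEN — the route's bet (US) at cluster level, axis frame only): every member of the cluster set has a
unit-light-cone Källén–Lehmann representation of its two-point kernel in the frame `e₂` (transverse coordinates
`(x₀, x₁)`): a positive measure on `(k ∈ ℝ²) × (ω ∈ ℝ)` giving no mass to `{ω < ‖k‖}`. -/
theorem stub_clusterUnitCone : open Literature.Probability.LatticeModels in ∀ S ∈ {S : CorrFamily 3 | (∀ n x, x ∉ NonCoincident 3 n → S n x = 0) ∧ ∃ u : ℕ → ℝ, (∀ k, u k ∈ Set.Ioc (0:ℝ) 1) ∧ Filter.Tendsto u Filter.atTop (nhds 0) ∧ ∀ n, TendstoLocallyUniformlyOn (fun k => rescaledCorrelator (criticalCorr 3) (fun δ : ℝ => (criticalTwoPoint 3 (Pi.single 0 ⌊δ⁻¹⌋)) ^ (-(1/2:ℝ))) n (u k)) (S n) Filter.atTop (NonCoincident 3 n)}, ∃ μ : MeasureTheory.Measure (EuclideanSpace ℝ (Fin 2) × ℝ), μ {p : EuclideanSpace ℝ (Fin 2) × ℝ | p.2 < ‖p.1‖} = 0 ∧ ∀ t a b : ℝ, t ≠ 0 → S 2 ![0, EuclideanSpace.single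 0 a + EuclideanSpace.single 1 b + EuclideanSpace.single 2 t] = ∫ p, Real.cos (p.1 0 * a + p.1 1 * b) * Real.exp (-(p.2 * |t|)) ∂μ := by
  sorry


/-- stub 4 (NEW, model-blind, provable now — THE TECHNIQUE: light-cone latitude rigidity WITHOUT homogeneity): a
positive kernel on `ℝ³ ∖ 0` with an upper envelope of exponent `a ∈ [0, 4)`, invariant under the hyperoctahedral
group (linear isometries permuting the signed coordinate axes) and admitting a unit-cone Källén–Lehmann representation
in the axis frame `e₂`, is RADIAL.  (Entire `2π`-periodic latitude functions of exponential type `a < 4` whose modes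
lie in `4ℤ` are constant; rotations about `e₂` and `e₀` generate `SO(3)`.) -/
theorem stub_radialRigidity : ∀ (a : ℝ) (K : EuclideanSpace ℝ (Fin 3) → ℝ), 0 ≤ a → a < 4 → (∀ x : EuclideanSpace ℝ (Fin 3), x ≠ 0 → 0 < K x) → (∃ C : ℝ, ∀ x : EuclideanSpace ℝ (Fin 3), x ≠ 0 → K x ≤ C * ‖x‖ ^ (-a)) → (∀ R : EuclideanSpace ℝ (Fin 3) ≃ₗᵢ[ℝ] EuclideanSpace ℝ (Fin 3), (∀ i : Fin 3, ∃ j : Fin 3, R (EuclideanSpace.single i 1) = EuclideanSpace.single j 1 ∨ R (EuclideanSpace.single i 1) = -EuclideanSpace.single j 1) → ∀ x : EuclideanSpace ℝ (Fin 3), K (R x) = K x) → (∃ μ : MeasureTheory.Measure (EuclideanSpace ℝ (Fin 2) × ℝ), μ {p : EuclideanSpace ℝ (Fin 2) × ℝ | p.2 < ‖p.1‖} = 0 ∧ ∀ t u v : ℝ, t ≠ 0 → K (EuclideanSpace.single 0 u + EuclideanSpace.single 1 v + EuclideanSpace.single 2 t) = ∫ p, Real.cos (p.1 0 * u + p.1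 1 * v) * Real.exp (-(p.2 * |t|)) ∂μ) → ∀ x y : EuclideanSpace ℝ (Fin 3), ‖x‖ = ‖y‖ → K x = K y := by
  sorry


/-- stub 5 = the birth line's load-bearing stub VERBATIM (OPEN, open-problem — isolation at fixed two-point function,
the `n ≥ 4` identification): every two-point fibre of the cluster set is totally disconnected. -/
theorem stub_fibrewiseTD : open Literature.Probability.LatticeModels in ∀ G : (Fin 2 → EuclideanSpace ℝ (Fin 3)) → ℝ, IsTotallyDisconnected {S : CorrFamily 3 | ((∀ n x, x ∉ NonCoincident 3 n → S n x = 0) ∧ ∃ u : ℕ → ℝ, (∀ k, u k ∈ Set.Ioc (0:ℝ) 1) ∧ Filter.Tendsto u Filter.atTop (nhds 0) ∧ ∀ n, TendstoLocallyUniformlyOn (fun k => rescaledCorrelator (criticalCorr 3) (fun δ : ℝ => (criticalTwoPoint 3 (Pi.single 0 ⌊δ⁻¹⌋)) ^ (-(1/2:ℝ))) n (u k)) (S n) Filter.atTop (NonCoincident 3 n)) ∧ S 2 = G} := by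
  sorry


/-! ### Name-keyed aliases of the stub statements (verbatim the types of the `stub_*` theorems above) -/
namespace Registered

/-- Alias of the statement of `stub_axisRV` (item 5047 by name). -/
abbrev stub_axisRV : Prop := Summit.CriticalPhenomena.Ising3DConformalLimit.Theses.BallOrbitComparison.TwoPointRegularVariation

/-- Alias of the statement of `stub_clusterKernelOfRV`. -/
abbrev stub_clusterKernelOfRV : Prop := open Literature.Probability.LatticeModels in Summit.CriticalPhenomena.Ising3DConformalLimit.Theses.BallOrbitComparison.TwoPointRegularVariation → ∃ Δ : ℝ, 1/2 ≤ Δ ∧ Δ ≤ 1 ∧ ∀ S ∈ {S : CorrFamily 3 | (∀ n x, x ∉ NonCoincident 3 n → S n x = 0) ∧ ∃ u : ℕ → ℝ, (∀ k, u k ∈ Set.Ioc (0:ℝ) 1) ∧ Filter.Tendsto u Filter.atTop (nhds 0) ∧ ∀ n, TendstoLocallyUniformlyOn (fun k => rescaledCorrelator (criticalCorr 3) (fun δ : ℝ => (criticalTwoPoint 3 (Pi.single 0 ⌊δ⁻¹⌋)) ^ (-(1/2:ℝ))) n (u k)) (S n) Filter.atTop (NonCoincident 3 n)}, (∀ x y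 : EuclideanSpace ℝ (Fin 3), x ≠ y → S 2 ![x, y] = S 2 ![0, y - x]) ∧ (∀ x : EuclideanSpace ℝ (Fin 3), x ≠ 0 → 0 < S 2 ![0, x]) ∧ (∀ R : EuclideanSpace ℝ (Fin 3) ≃ₗᵢ[ℝ] EuclideanSpace ℝ (Fin 3), (∀ i : Fin 3, ∃ j : Fin 3, R (EuclideanSpace.single i 1) = EuclideanSpace.single j 1 ∨ R (EuclideanSpace.single i 1) = -EuclideanSpace.single j 1) → ∀ x : EuclideanSpace ℝ (Fin 3), S 2 ![0, R x] = S 2 ![0, x]) ∧ (∀ r : ℝ, 0 < r → S 2 ![0, r • EuclideanSpace.single (0 : Fin 3) (1:ℝ)] = r ^ (-(2 * Δ))) ∧ (∃ C : ℝ, ∀ x : EuclideanSpace ℝ (Fin 3), x ≠ 0 → S 2 ![0, x] ≤ C * ‖x‖ ^ (-(2 * Δ)))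

/-- Alias of the statement of `stub_clusterUnitCone`. -/
abbrev stub_clusterUnitCone : Prop := open Literature.Probability.LatticeModels in ∀ S ∈ {S : CorrFamily 3 | (∀ n x, x ∉ NonCoincident 3 n → S n x = 0) ∧ ∃ u : ℕ → ℝ, (∀ k, u k ∈ Set.Ioc (0:ℝ) 1) ∧ Filter.Tendsto u Filter.atTop (nhds 0) ∧ ∀ n, TendstoLocallyUniformlyOn (fun k => rescaledCorrelator (criticalCorr 3) (fun δ : ℝ => (criticalTwoPoint 3 (Pi.single 0 ⌊δ⁻¹⌋)) ^ (-(1/2:ℝ))) n (u k)) (S n) Filter.atTop (NonCoincident 3 n)}, ∃ μ : MeasureTheory.Measure (EuclideanSpace ℝ (Fin 2) × ℝ), μ {p : EuclideanSpace ℝ (Fin 2) × ℝ | p.2 < ‖p.1‖} = 0 ∧ ∀ t a b : ℝ, t ≠ 0 → S 2 ![0, EuclideanSpace.single 0 a + EuclideanSpace.single 1 b + EuclideanSpace.single 2 t] = ∫ p, Real.cos (p.1 0 * a + p.1 1 * b) * Real.exp (-(p.2 * |t|)) ∂μ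

/-- Alias of the statement of `stub_radialRigidity`. -/
abbrev stub_radialRigidity : Prop := ∀ (a : ℝ) (K : EuclideanSpace ℝ (Fin 3) → ℝ), 0 ≤ a → a < 4 → (∀ x : EuclideanSpace ℝ (Fin 3), x ≠ 0 → 0 < K x) → (∃ C : ℝ, ∀ x : EuclideanSpace ℝ (Fin 3), x ≠ 0 → K x ≤ C * ‖x‖ ^ (-a)) → (∀ R : EuclideanSpace ℝ (Fin 3) ≃ₗᵢ[ℝ] EuclideanSpace ℝ (Fin 3), (∀ i : Fin 3, ∃ j : Fin 3, R (EuclideanSpace.single i 1) = EuclideanSpace.single j 1 ∨ R (EuclideanSpace.single i 1) = -EuclideanSpace.single j 1) → ∀ x : EuclideanSpace ℝ (Fin 3), K (R x) = K x) → (∃ μ : MeasureTheory.Measure (EuclideanSpace ℝ (Fin 2) × ℝ), μ {p : EuclideanSpace ℝ (Fin 2) × ℝ | p.2 < ‖p.1‖} = 0 ∧ ∀ t u v : ℝ, t ≠ 0 → K (EuclideanSpace.single 0 u + EuclideanSpace.single 1 v + EuclideanSpace.single 2 t) = ∫ p, Real.cos (p.1 0 * u + p.1 1 * v) * Real.exp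 (-(p.2 * |t|)) ∂μ) → ∀ x y : EuclideanSpace ℝ (Fin 3), ‖x‖ = ‖y‖ → K x = K y

/-- Alias of the statement of `stub_fibrewiseTD` (= birth's registered stub). -/
abbrev stub_fibrewiseTD : Prop := open Literature.Probability.LatticeModels in ∀ G : (Fin 2 → EuclideanSpace ℝ (Fin 3)) → ℝ, IsTotallyDisconnected {S : CorrFamily 3 | ((∀ n x, x ∉ NonCoincident 3 n → S n x = 0) ∧ ∃ u : ℕ → ℝ, (∀ k, u k ∈ Set.Ioc (0:ℝ) 1) ∧ Filter.Tendsto u Filter.atTop (nhds 0) ∧ ∀ n, TendstoLocallyUniformlyOn (fun k => rescaledCorrelator (criticalCorr 3) (fun δ : ℝ => (criticalTwoPoint 3 (Pi.single 0 ⌊δ⁻¹⌋)) ^ (-(1/2:ℝ))) n (u k)) (S n) Filter.atTop (NonCoincident 3 n)) ∧ S 2 = G}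

end Registered


/-! ### Glue (all proved) -/
section Glue

variable {X Y : Type*} [TopologicalSpace X] [TopologicalSpace Y]

/-- Fibrewise total-disconnectedness principle (the birth line's glue lemma, re-proved verbatim so that this file
imports no sorried module): a continuous-on-`s` map with totally disconnected image and totally disconnected fibres
has a totally disconnected domain `s`. [folklore] -/
theorem isTotallyDisconnected_of_fibres {s : Set X} (f : X → Y) (hf : ContinuousOn f s)
    (himg : IsTotallyDisconnected (f '' s))
    (hfib : ∀ y, IsTotallyDisconnected {x : X | x ∈ s ∧ f x = y}) :
    IsTotallyDisconnected s := by
  intro t hts ht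
  rcases t.eq_empty_or_nonempty with rfl | ⟨x₀, hx₀⟩
  · exact subsingleton_empty
  have himg_t : (f '' t).Subsingleton :=
    himg (f '' t) (image_mono hts) (ht.image f (hf.mono hts))
  refine hfib (f x₀) t (fun x hx => ⟨hts hx, ?_⟩) ht
  exact himg_t (mem_image_of_mem f hx) (mem_image_of_mem f hx₀)

/-- A subsingleton is totally disconnected. [folklore] -/
theorem isTotallyDisconnected_of_subsingleton {s : Set X} (hs : s.Subsingleton) :
    IsTotallyDisconnected s :=
  fun _t hts _ => hs.anti hts

open Literature.Probability.LatticeModels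

/-- The forced renormalisation `ρ★(δ) := ⟨σ₀ σ_{⌊δ⁻¹⌋ e₀}⟩_{β_c(3)}^{-1/2}` (verbatim the crux's). -/
noncomputable def rhoStar : ℝ → ℝ := fun δ : ℝ => (criticalTwoPoint 3 (Pi.single 0 ⌊δ⁻¹⌋)) ^ (-(1/2:ℝ))

/-- The cluster set `𝒞` of the crux (verbatim its set-builder, with `ρ★` named). -/
def clusterSet : Set (CorrFamily 3) :=
  {S | (∀ n x, x ∉ NonCoincident 3 n → S n x = 0) ∧ ∃ u : ℕ → ℝ, (∀ k, u k ∈ Set.Ioc (0:ℝ) 1) ∧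
    Filter.Tendsto u Filter.atTop (nhds 0) ∧ ∀ n, TendstoLocallyUniformlyOn
      (fun k => rescaledCorrelator (criticalCorr 3) rhoStar n (u k)) (S n) Filter.atTop (NonCoincident 3 n)}

/-- The common two-point function forced on the cluster set: `‖z 1 − z 0‖^{-2Δ}` off the diagonal, `0` on it. -/
noncomputable def Gstar (Δ : ℝ) : (Fin 2 → EuclideanSpace ℝ (Fin 3)) → ℝ :=
  fun z => if z 0 = z 1 then 0 else ‖z 1 - z 0‖ ^ (-(2 * Δ))

/-- The crux (UnitLightCone copy), read through the vocabulary (definitional). -/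
theorem clusterSetTotallyDisconnected_iff :
    Summit.CriticalPhenomena.Ising3DConformalLimit.Theses.UnitLightCone.ClusterSetTotallyDisconnected ↔
      IsTotallyDisconnected clusterSet :=
  Iff.rfl

/-- Stub 2, read through the vocabulary (definitional). -/
theorem stub_clusterKernelOfRV_iff :
    Registered.stub_clusterKernelOfRV ↔
      (Summit.CriticalPhenomena.Ising3DConformalLimit.Theses.BallOrbitComparison.TwoPointRegularVariation →
        ∃ Δ : ℝ, 1/2 ≤ Δ ∧ Δ ≤ 1 ∧ ∀ S ∈ clusterSet,
          (∀ x y : EuclideanSpace ℝ (Fin 3), x ≠ y → S 2 ![x, y] = S 2 ![0, y - x]) ∧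
          (∀ x : EuclideanSpace ℝ (Fin 3), x ≠ 0 → 0 < S 2 ![0, x]) ∧
          (∀ R : EuclideanSpace ℝ (Fin 3) ≃ₗᵢ[ℝ] EuclideanSpace ℝ (Fin 3),
            (∀ i : Fin 3, ∃ j : Fin 3, R (EuclideanSpace.single i 1) = EuclideanSpace.single j 1 ∨
              R (EuclideanSpace.single i 1) = -EuclideanSpace.single j 1) →
            ∀ x : EuclideanSpace ℝ (Fin 3), S 2 ![0, R x] = S 2 ![0, x]) ∧
          (∀ r : ℝ, 0 < r → S 2 ![0, r • EuclideanSpace.single (0 : Fin 3) (1:ℝ)] = r ^ (-(2 * Δ))) ∧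
          (∃ C : ℝ, ∀ x : EuclideanSpace ℝ (Fin 3), x ≠ 0 → S 2 ![0, x] ≤ C * ‖x‖ ^ (-(2 * Δ)))) :=
  Iff.rfl

/-- Stub 3, read through the vocabulary (definitional). -/
theorem stub_clusterUnitCone_iff :
    Registered.stub_clusterUnitCone ↔
      ∀ S ∈ clusterSet, ∃ μ : MeasureTheory.Measure (EuclideanSpace ℝ (Fin 2) × ℝ),
        μ {p : EuclideanSpace ℝ (Fin 2) × ℝ | p.2 < ‖p.1‖} = 0 ∧ ∀ t a b : ℝ, t ≠ 0 →
          S 2 ![0, EuclideanSpace.single 0 a + EuclideanSpace.single 1 b + EuclideanSpace.single 2 t] =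
            ∫ p, Real.cos (p.1 0 * a + p.1 1 * b) * Real.exp (-(p.2 * |t|)) ∂μ :=
  Iff.rfl

/-- Stub 5, read through the vocabulary (definitional). -/
theorem stub_fibrewiseTD_iff :
    Registered.stub_fibrewiseTD ↔ ∀ G : (Fin 2 → EuclideanSpace ℝ (Fin 3)) → ℝ,
      IsTotallyDisconnected {S : CorrFamily 3 | S ∈ clusterSet ∧ (fun S : CorrFamily 3 => S 2) S = G} :=
  Iff.rfl

/-- The two-point projection is continuous for the product topology. [folklore] -/
theorem continuous_twoPoint : Continuous (fun S : CorrFamily 3 => S 2) :=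
  continuous_apply 2

/-- A pair `![x, y]` with `x ≠ y` is non-coincident; the diagonal pair is not. [folklore] -/
theorem pair_not_mem_nonCoincident_of_eq {z : Fin 2 → EuclideanSpace ℝ (Fin 3)} (hz : z 0 = z 1) :
    z ∉ NonCoincident 3 2 := by
  rw [mem_nonCoincident]
  intro hinj
  exact absurd (hinj hz) (by decide)

/-- **The radial step** (glue over stubs 2–4): under their conclusions every member of the cluster set has the SAME
two-point function `G★_Δ`. -/
theorem twoPoint_eq_Gstar {Δ : ℝ} (hΔlo : 1/2 ≤ Δ) (hΔhi : Δ ≤ 1)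
    (hfacts : ∀ S ∈ clusterSet,
      (∀ x y : EuclideanSpace ℝ (Fin 3), x ≠ y → S 2 ![x, y] = S 2 ![0, y - x]) ∧
      (∀ x : EuclideanSpace ℝ (Fin 3), x ≠ 0 → 0 < S 2 ![0, x]) ∧
      (∀ R : EuclideanSpace ℝ (Fin 3) ≃ₗᵢ[ℝ] EuclideanSpace ℝ (Fin 3),
        (∀ i : Fin 3, ∃ j : Fin 3, R (EuclideanSpace.single i 1) = EuclideanSpace.single j 1 ∨
          R (EuclideanSpace.single i 1) = -EuclideanSpace.single j 1) →
        ∀ x : EuclideanSpace ℝ (Fin 3), S 2 ![0, R x] = S 2 ![0, x]) ∧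
      (∀ r : ℝ, 0 < r → S 2 ![0, r • EuclideanSpace.single (0 : Fin 3) (1:ℝ)] = r ^ (-(2 * Δ))) ∧
      (∃ C : ℝ, ∀ x : EuclideanSpace ℝ (Fin 3), x ≠ 0 → S 2 ![0, x] ≤ C * ‖x‖ ^ (-(2 * Δ))))
    (hcone : ∀ S ∈ clusterSet, ∃ μ : MeasureTheory.Measure (EuclideanSpace ℝ (Fin 2) × ℝ),
        μ {p : EuclideanSpace ℝ (Fin 2) × ℝ | p.2 < ‖p.1‖} = 0 ∧ ∀ t a b : ℝ, t ≠ 0 →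
          S 2 ![0, EuclideanSpace.single 0 a + EuclideanSpace.single 1 b + EuclideanSpace.single 2 t] =
            ∫ p, Real.cos (p.1 0 * a + p.1 1 * b) * Real.exp (-(p.2 * |t|)) ∂μ)
    (hrad : Registered.stub_radialRigidity) :
    ∀ S ∈ clusterSet, S 2 = Gstar Δ := by
  intro S hS
  obtain ⟨hTI, hpos, hcub, haxis, C, henv⟩ := hfacts S hS
  obtain ⟨μ, hμ, hKL⟩ := hcone S hS
  -- the kernel `K_S x = S 2 (0,x)` is radial by stub 4 at `a = 2Δ`
  have hradial : ∀ x y : EuclideanSpace ℝ (Fin 3), ‖x‖ = ‖y‖ → S 2 ![0, x] = S 2 ![0, y] :=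
    hrad (2 * Δ) (fun x => S 2 ![0, x]) (by linarith) (by linarith) hpos ⟨C, henv⟩ hcub ⟨μ, hμ, hKL⟩
  -- hence equal to the pinned axis profile
  have hK : ∀ x : EuclideanSpace ℝ (Fin 3), x ≠ 0 → S 2 ![0, x] = ‖x‖ ^ (-(2 * Δ)) := by
    intro x hx
    have hnorm : ‖x‖ = ‖(‖x‖ • EuclideanSpace.single (0 : Fin 3) (1:ℝ) : EuclideanSpace ℝ (Fin 3))‖ := by
      rw [norm_smul, Real.norm_of_nonneg (norm_nonneg x)]
      simp
    rw [hradial x _ hnorm, haxis ‖x‖ (norm_pos_iff.2 hx)]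
  funext z
  by_cases hz : z 0 = z 1
  · rw [hS.1 2 z (pair_not_mem_nonCoincident_of_eq hz)]
    simp [Gstar, hz]
  · have e1 : S 2 z = S 2 ![z 0, z 1] := by
      congr 1
      funext i
      fin_cases i <;> rfl
    rw [e1, hTI (z 0) (z 1) hz, hK _ (sub_ne_zero.2 (Ne.symm hz))]
    simp [Gstar, hz]

end Glue

open Literature.Probability.LatticeModels in
/-- ASSEMBLY (kernel-checked, no sorry): the five stubs imply the crux, literally the route decl
`Summit.CriticalPhenomena.Ising3DConformalLimit.Theses.UnitLightCone.ClusterSetTotallyDisconnected`. -/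
theorem ClusterSetTotallyDisconnected_of (h1 : Registered.stub_axisRV) (h2 : Registered.stub_clusterKernelOfRV)
    (h3 : Registered.stub_clusterUnitCone) (h4 : Registered.stub_radialRigidity) (h5 : Registered.stub_fibrewiseTD) :
    Summit.CriticalPhenomena.Ising3DConformalLimit.Theses.UnitLightCone.ClusterSetTotallyDisconnected := by
  rw [clusterSetTotallyDisconnected_iff]
  rw [stub_clusterKernelOfRV_iff] at h2
  rw [stub_clusterUnitCone_iff] at h3
  rw [stub_fibrewiseTD_iff] at h5
  obtain ⟨Δ, hΔlo, hΔhi, hfacts⟩ := h2 h1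
  have hcommon : ∀ S ∈ clusterSet, S 2 = Gstar Δ := twoPoint_eq_Gstar hΔlo hΔhi hfacts h3 h4
  have himg : IsTotallyDisconnected ((fun S : CorrFamily 3 => S 2) '' clusterSet) := by
    refine isTotallyDisconnected_of_subsingleton ?_
    rintro _ ⟨S, hS, rfl⟩ _ ⟨T, hT, rfl⟩
    simp only [hcommon S hS, hcommon T hT]
  exact isTotallyDisconnected_of_fibres (fun S : CorrFamily 3 => S 2) continuous_twoPoint.continuousOn himg h5

/-- The same assembly with the registered stubs plugged in (alias consistency; sorries only inside `stub_*`). -/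
theorem ClusterSetTotallyDisconnected_of_stubs :
    Summit.CriticalPhenomena.Ising3DConformalLimit.Theses.UnitLightCone.ClusterSetTotallyDisconnected :=
  ClusterSetTotallyDisconnected_of stub_axisRV stub_clusterKernelOfRV stub_clusterUnitCone stub_radialRigidity
    stub_fibrewiseTD

/-- Route-sharing: the ClusterRigidity copy of the crux (the item's primary decl; the body is shared verbatim by
every wanting route, so the transport is `Iff.rfl`). -/
theorem ClusterSetTotallyDisconnected_of_clusterRigidity (h1 : Registered.stub_axisRV)
    (h2 : Registered.stub_clusterKernelOfRV) (h3 : Registered.stub_clusterUnitCone)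
    (h4 : Registered.stub_radialRigidity) (h5 : Registered.stub_fibrewiseTD) :
    Summit.CriticalPhenomena.Ising3DConformalLimit.Theses.ClusterRigidity.ClusterSetTotallyDisconnected :=
  (clusterSetTotallyDisconnected_iff).1 (ClusterSetTotallyDisconnected_of h1 h2 h3 h4 h5)

/-- The ClusterRigidity copy with the registered stubs plugged in (sorries only inside `stub_*`). -/
theorem ClusterSetTotallyDisconnected_of_clusterRigidity_stubs :
    Summit.CriticalPhenomena.Ising3DConformalLimit.Theses.ClusterRigidity.ClusterSetTotallyDisconnected :=
  ClusterSetTotallyDisconnected_of_clusterRigidity stub_axisRV stub_clusterKernelOfRV stub_clusterUnitCone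
    stub_radialRigidity stub_fibrewiseTD

end Summit.CriticalPhenomena.Ising3DConformalLimit.Cruxes.ClusterSetTotallyDisconnected.ClusterLightCone
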